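import Summits.QuantumFields.YangMills.Theorems.BalabanLadderIRColdPurityBridge
import Literature.MathematicalPhysics.QuantumFieldTheory.WilsonFinTorusPartitionComplex
import HarnessLib

/-!
# Crux `IR` (stmt-QuantumFields-19354) — VOCABULARY of the purity-channel family of lines
# (`harmonic-purity-channel`, `jensen-purity-channel`; ideator ym-ir-idea-16) as tree constants

Helper module for item `stmt-QuantumFields-19354` (`--supports … --as helper`; it closes nothing and asserts nothing).
The two ideator workfiles `Cruxes/IR/Lines/harmonic_purity_channel.lean` (commit as of 2026-08-28T03:04Z) and
`Cruxes/IR/Lines/jensen_purity_channel.lean` (03:42Z) — UNREGISTERED skeletons of the crux `BalabanLadder.IR`, critic of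
record ym-ir-crit-4 (LINE 1 PRICE: «LOAD Z = the wall re-typed, STRONGER than E»; LINE 2 lowers the load) — each carry an
in-file copy of the same CURRENCY (§1: the cold-torus partition function `Z[w]` with an arbitrary complex plaquette weight, the
complex purity ratio `h_L[w]`, the complex Wilson weight) and their STATEMENTS (§2: the loads `PurityChannel` / `SparseChannel`,
the shared located supplier `ComplexAnchor`, the classical legs `TwoConstants` / `PoissonJensen`), because crux workfiles are not
importable modules.  This file makes them tree constants VERBATIM (namespace `…Cruxes.IR.PurityChannelFamily`), so that

* the companion `Theorems/IR/PurityChannelSeams.lean` can PROVE the two seams `stub_exit_of_channel :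
  PurityChannel → ComplexAnchor → TwoConstants → ColdExitSC` and `stub_exit_of_sparse : SparseChannel → ComplexAnchor →
  PoissonJensen → ColdExitSC` as theorems about THESE constants (each workfile stub then closes by `exact` — the bodies are
  syntactically the workfiles', checked on the farm against verbatim copies), and
* a future supplier proof of `ComplexAnchor` (Kotecký–Preiss for a near-Haar complex plaquette activity) has a name to target.

The classical legs are ALREADY tree theorems (`Theorems/IR/PurityChannelClassical.lean`, p635605: `twoConstants_holds`,
`poissonJensen_holds`, stated there with the bodies unfolded); the seams file re-exports them over the names below.

NOTHING here is asserted: `def … : Prop` are LINE STATEMENTS (hypotheses of a conditional line), not literature facts and not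
claims; `weightFinTorusPartition` / `purityRatio` / `wilsonWeightC` / `greenBudget` / `zeroProd` are the route-posited objects.

HONEST FRAMING.  The loads `PurityChannel` ⊋ `SparseChannel` are the infrared wall of `BalabanLadder.IR` re-typed in
complex-analytic currency (crit-4: width 0 toward IR); `ComplexAnchor` is a located but OPEN supplier; nothing in this file or its
companion bears on confinement, a lattice gap, `IR` (0/1) or the Yang–Mills mass gap (Clay), which are NOT proved; `R4` closes only
the conditional finite-𝕋⁴ rung `BalabanLadder.UV`.
Cards: `Cruxes/IR/Lines/harmonic-purity-channel.md`, `Cruxes/IR/Lines/jensen-purity-channel.md`; pool file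
`Cruxes/IR/Lines/purity_channel_classical.lean`.
-/

set_option autoImplicit false

noncomputable section

open Filter Topology MeasureTheory
open Literature.MathematicalPhysics.QuantumFieldTheory Literature.MathematicalPhysics.QuantumLattice

namespace Summit.QuantumFields.YangMills.Cruxes.IR.PurityChannelFamily

/-! ## §1 Currency (VERBATIM §1 / §1b of the two workfiles): cold-torus partition functions with an arbitrary complex plaquette weight -/

section Defs

variable {G : Type} [Group G] [TopologicalSpace G] [IsTopologicalGroup G] [CompactSpace G]
  [MeasurableSpace G] [BorelSpace G]

/-- The partition function of the `Fin`-indexed four-torus `n₀ × n₁ × n₂ × n₃` with an arbitrary complex plaquette weight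
`w : G → ℂ` (product of normalised Haar measures over the positively oriented links):
`Z[w](n₀,n₁,n₂,n₃) = ∫ ∏_x ∏_{μ<ν} w(U_{x,μν}) ∏ dHaar`.  For `w = exp(−β (N − Re tr ρ ·))` it is `wilsonFinTorusPartition ρ β`
(`PurityChannelSeams.weightFinTorusPartition_wilsonWeightC_ofReal`, companion file). -/
def weightFinTorusPartition (w : G → ℂ) (n₀ n₁ n₂ n₃ : ℕ) : ℂ :=
  ∫ U, ∏ x : FinTorusSite n₀ n₁ n₂ n₃, ∏ q : {q : Fin 4 × Fin 4 // q.1 < q.2},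
      w (finTorusPlaquette U x q.1.1 q.1.2)
    ∂(Measure.pi fun _ : FinTorusSite n₀ n₁ n₂ n₃ × Fin 4 => haarProbability G)

/-- The complex **purity ratio** of the cold tori of side `L`: `h_L[w] = Z[w](L,L,L,2⌊L/4⌋) / Z[w](L,L,L,⌊L/4⌋)²`
(= `tr 𝒯^{2t} / (tr 𝒯^t)²` when a transfer operator exists; `1 − h_L` = the cold period-doubling defect `coldDefect` at a real
Wilson weight).  Bulk free energies cancel exactly in it. -/
def purityRatio (w : G → ℂ) (L : ℕ) : ℂ :=
  weightFinTorusPartition w L L L (2 * (L / 4)) / weightFinTorusPartition w L L L (L / 4) ^ 2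

/-- The Wilson plaquette weight of the representation `ρ` at COMPLEX coupling `z`: `g ↦ exp(−z (N − Re tr ρ(g)))`. -/
def wilsonWeightC {N : ℕ} (ρ : G →* Matrix (Fin N) (Fin N) ℂ) (z : ℂ) : G → ℂ :=
  fun g => Complex.exp (-(z * ((((N : ℝ) - (ρ g).trace.re) : ℝ) : ℂ)))

end Defs

/-- The Green-potential budget of a multiset of zeros `s` seen from the target `zT` inside a disc of radius `R` about `zT`:
`Σ_{ζ∈s} log(R/‖ζ − zT‖)` — an upper bound for `Σ g_Ω(zT, ζ)` whenever `Ω ⊆ B(zT, R)` (domain monotonicity of Green's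
function; `g_{B(zT,R)}(zT,ζ) = log(R/‖ζ − zT‖)`). -/
def greenBudget (s : Multiset ℂ) (zT : ℂ) (R : ℝ) : ℝ :=
  (s.map fun ζ => Real.log (R / ‖ζ - zT‖)).sum

/-- The monic Blaschke-type polynomial `∏_{ζ∈s} (z − ζ)`. -/
def zeroProd (s : Multiset ℂ) (z : ℂ) : ℂ :=
  (s.map fun ζ => z - ζ).prod

/-! ## §2 The statements of the two lines (VERBATIM; hypotheses of conditional lines — nothing is claimed) -/

/-- **LOAD `PurityChannel` (XL — the infrared wall in complex-analytic currency).**  For compact simple simply-connected `G`,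
every faithful unitary lattice representation `r`, every anchor tolerance `ε > 0`, and every weak coupling `β ≥ β₁(G,r)`:
there is a HOLOMORPHIC CHANNEL — an open connected `D ⊂ ℂ`, a family of complex plaquette weights `w : D → (G → ℂ)`
holomorphic in `z` for each group element, continuous and uniformly bounded, `ε`-close to the Haar weight `1` on a closed
anchor disc `B̄(z₀,δ₀) ⊆ D`, equal to the Wilson weight of `r` at `β` at a target point `z_T ∈ D` — along which, for all
`L ≥ L₀`, the cold partition function `Z[w_z](L³×⌊L/4⌋)` has NO zero and the purity ratio is bounded, `‖h_L[w_z]‖ ≤ M`.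
(«No wall of cold-torus Fisher zeros / purity blow-ups separates strong from weak coupling.»)  Why it might fail: it is
false exactly where E is false — `U(1)₄` (zeros pinch the real axis at the Coulomb transition), `π₁(G) ≠ 1` (light flux makes
`h_L → 1/|π₁|³`-type impurity, so a blow-up/zero wall must cross every channel); for simple simply-connected `G` it is the
complex shadow of «no deconfining bulk transition», asserted nowhere.
[line `harmonic-purity-channel`, LOAD; verbatim] -/
def PurityChannel : Prop :=
  ∀ (G : Type) [Group G] [TopologicalSpace G] [IsTopologicalGroup G] [CompactSpace G],
    IsCompactSimpleLieGroup G → SimplyConnectedSpace G →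
    letI : MeasurableSpace G := borel G
    haveI : BorelSpace G := ⟨rfl⟩
    ∀ r : LatticeRep G, ∀ ε : ℝ, 0 < ε → ∃ β₁ : ℝ, ∀ β : ℝ, β₁ ≤ β →
      ∃ (D : Set ℂ) (w : ℂ → G → ℂ) (z₀ zT : ℂ) (δ₀ M B : ℝ) (L₀ : ℕ),
        IsOpen D ∧ IsConnected D ∧ 0 < δ₀ ∧ Metric.closedBall z₀ δ₀ ⊆ D ∧ zT ∈ D ∧
        (∀ g : G, DifferentiableOn ℂ (fun z => w z g) D) ∧
        (∀ z ∈ D, Continuous (w z)) ∧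
        (∀ z ∈ D, ∀ g : G, ‖w z g‖ ≤ B) ∧
        (∀ z ∈ Metric.closedBall z₀ δ₀, ∀ g : G, ‖w z g - 1‖ ≤ ε) ∧
        w zT = wilsonWeightC r.ρ (β : ℂ) ∧
        ∀ L : ℕ, L₀ ≤ L → ∀ z ∈ D,
          weightFinTorusPartition (w z) L L L (L / 4) ≠ 0 ∧ ‖purityRatio (w z) L‖ ≤ M

/-- **`ComplexAnchor` (L — located supplier: complex strong coupling).**  There are ABSOLUTE constants `ε₀, C, c > 0`, `L₀`
such that for every compact metrisable group `G` and every continuous complex plaquette weight `w` with `‖w − 1‖∞ ≤ ε₀` the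
cold partition function `Z[w](L³×⌊L/4⌋)` is non-zero and `‖1 − h_L[w]‖ ≤ C L⁴ e^{−cL}` for all `L ≥ L₀` (Kotecký–Preiss
polymer expansion of the plaquette gas with activity `w − 1`: bulk clusters cancel in the ratio, only clusters wrapping the
time circle of length `⌊L/4⌋` survive).  The complex-WILSON instance is in tree (`PeriodicBoxFreeEnergyLimits.exists_tube_rate`:
`‖log Z(N³×t)(z) − t e_N(z)‖ ≤ 12 N³ t e^{−⌊t/2⌋}`, `‖z‖ ≤ r_ρ`); the real instance is `coldDefect_le_of_strongCoupling`.
[shared located supplier of both lines; verbatim] -/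
def ComplexAnchor : Prop :=
  ∃ ε₀ C c : ℝ, 0 < ε₀ ∧ 0 < c ∧ ∃ L₀ : ℕ,
    ∀ (G : Type) [Group G] [TopologicalSpace G] [IsTopologicalGroup G] [CompactSpace G]
      [SecondCountableTopology G] [MeasurableSpace G] [BorelSpace G],
      ∀ w : G → ℂ, Continuous w → (∀ g : G, ‖w g - 1‖ ≤ ε₀) →
        ∀ L : ℕ, L₀ ≤ L →
          weightFinTorusPartition w L L L (L / 4) ≠ 0 ∧
          ‖1 - purityRatio w L‖ ≤ C * (L : ℝ) ^ 4 * Real.exp (-(c * (L : ℝ)))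

/-- **`TwoConstants` (M — classical complex analysis: Nevanlinna's two-constants theorem in the weak form «propagation of
smallness along a chain of Hadamard three-circles»).**  For an open connected `D ⊆ ℂ`, a closed disc `B̄(z₀,δ₀) ⊆ D` and a
point `z_T ∈ D` there is an exponent `ω ∈ (0,1]` — a lower bound for the harmonic measure of the disc seen from `z_T` —
such that EVERY `F` holomorphic on `D` with `‖F‖ ≤ A` on `D` and `‖F‖ ≤ a` on the disc (`0 < a ≤ A`) obeys
`‖F(z_T)‖ ≤ a^ω A^{1−ω}`.  (Mathlib: `Complex.HadamardThreeLines` after `z = c + e^{u}` gives three-circles; chain the discs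
along a compact path from `z₀` to `z_T`.)
[line `harmonic-purity-channel`, classical leg T; verbatim; PROVED: `PurityChannelSeams.twoConstants_holds` ← p635605] -/
def TwoConstants : Prop :=
  ∀ (D : Set ℂ), IsOpen D → IsConnected D →
    ∀ (z₀ : ℂ) (δ₀ : ℝ), 0 < δ₀ → Metric.closedBall z₀ δ₀ ⊆ D → ∀ zT : ℂ, zT ∈ D →
      ∃ ω : ℝ, 0 < ω ∧ ω ≤ 1 ∧
        ∀ F : ℂ → ℂ, DifferentiableOn ℂ F D →
          ∀ a A : ℝ, 0 < a → a ≤ A →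
            (∀ z ∈ D, ‖F z‖ ≤ A) → (∀ z ∈ Metric.closedBall z₀ δ₀, ‖F z‖ ≤ a) →
              ‖F zT‖ ≤ a ^ ω * A ^ (1 - ω)

/-- **LOAD `SparseChannel` (XL — the infrared wall, typed LOWER than LINE 1's `PurityChannel`).**  For compact simple
simply-connected `G`, faithful `r`, anchor tolerance `ε > 0` and every weak coupling `β ≥ β₁(G,r)`: channel data — open sets
`closure D ⊆ U`, `D` bounded, connected, containing a closed anchor disc `B̄(z₀,δ₀)` with `D ∖ B̄(z₀,δ₀)` connected, a target
`zT ∈ D` off the disc, `D ⊆ B(zT,R)`; a family `w : U → (G → ℂ)` of complex plaquette weights holomorphic in `z`, continuous,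
bounded by `B`, `ε`-near the Haar weight on the disc, equal to Wilson's weight of `r` at `β` at `zT`; and a sequence
`θ_L → 0` — such that for all `L ≥ L₀`: (i) ON THE BOUNDARY `frontier D` the cold partition function `Z_t = Z[w_z](L³×⌊L/4⌋)`
has no zero and `‖h_L‖ ≤ M`; (ii) INSIDE, `Z_t = g · ∏_{ζ∈s}(· − ζ)` on `closure D` for a finite multiset `s ⊆ D ∖ {zT}` and a
`g` holomorphic on `U`, zero-free on `closure D`, with Green budget `Σ_{ζ∈s} log(R/‖ζ − zT‖) ≤ θ_L · L`.
Why it might fail: false exactly where E is false — at a deconfining or bulk wall the zeros of the cold torus form EXTENSIVE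
families (count `∝ L⁴` in any fixed box the family crosses; `U(1)₄` pinch at β ≈ 1.01), so the budget is violated by `L³`, not met
by `o(L)`; for `π₁(G) ≠ 1` light flux forces a wall on every channel.  Relative to LINE 1 it tolerates `o(L)`-potential
intruders and asks boundedness/zero-freeness of `h_L` on the contour only.
[line `jensen-purity-channel`, LOAD; verbatim] -/
def SparseChannel : Prop :=
  ∀ (G : Type) [Group G] [TopologicalSpace G] [IsTopologicalGroup G] [CompactSpace G],
    IsCompactSimpleLieGroup G → SimplyConnectedSpace G →
    letI : MeasurableSpace G := borel G
    haveI : BorelSpace G := ⟨rfl⟩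
    ∀ r : LatticeRep G, ∀ ε : ℝ, 0 < ε → ∃ β₁ : ℝ, ∀ β : ℝ, β₁ ≤ β →
      ∃ (U D : Set ℂ) (w : ℂ → G → ℂ) (z₀ zT : ℂ) (δ₀ R M B : ℝ) (θ : ℕ → ℝ) (L₀ : ℕ),
        IsOpen U ∧ IsOpen D ∧ Bornology.IsBounded D ∧ IsConnected D ∧ closure D ⊆ U ∧
        0 < δ₀ ∧ Metric.closedBall z₀ δ₀ ⊆ D ∧ IsConnected (D \ Metric.closedBall z₀ δ₀) ∧
        zT ∈ D ∧ δ₀ < ‖zT - z₀‖ ∧ D ⊆ Metric.ball zT R ∧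
        (∀ g : G, DifferentiableOn ℂ (fun z => w z g) U) ∧
        (∀ z ∈ U, Continuous (w z)) ∧
        (∀ z ∈ U, ∀ g : G, ‖w z g‖ ≤ B) ∧
        (∀ z ∈ Metric.closedBall z₀ δ₀, ∀ g : G, ‖w z g - 1‖ ≤ ε) ∧
        w zT = wilsonWeightC r.ρ (β : ℂ) ∧
        Tendsto θ atTop (nhds 0) ∧
        ∀ L : ℕ, L₀ ≤ L →
          (∀ z ∈ frontier D,
              weightFinTorusPartition (w z) L L L (L / 4) ≠ 0 ∧ ‖purityRatio (w z) L‖ ≤ M) ∧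
          ∃ (s : Multiset ℂ) (g : ℂ → ℂ),
            (∀ ζ ∈ s, ζ ∈ D ∧ ζ ≠ zT) ∧
            greenBudget s zT R ≤ θ L * (L : ℝ) ∧
            DifferentiableOn ℂ g U ∧ (∀ z ∈ closure D, g z ≠ 0) ∧
            ∀ z ∈ closure D, weightFinTorusPartition (w z) L L L (L / 4) = g z * zeroProd s z

/-- **`PoissonJensen` (M — classical potential theory, stated without measures).**  Geometry: `closure D ⊆ U` open, `D` open
bounded connected, a closed disc `B̄(z₀,δ₀) ⊆ D` with `Ω := D ∖ B̄(z₀,δ₀)` connected, a target `zT ∈ D` off the disc, `D ⊆ B(zT,R)`.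
Then there is `ω ∈ (0,1]` (a lower bound for the harmonic measure of the anchor circle seen from `zT` in `Ω`) such that for all
`F, g` holomorphic on `U`, `g` zero-free on `closure D`, every finite multiset `s ⊆ Ω ∖ {zT}` and `G := g · ∏_{ζ∈s}(· − ζ)`:
if `‖F‖ ≤ A‖G‖` on `frontier D` and `‖F‖ ≤ a‖G‖` on the circle `sphere z₀ δ₀` (`0 < a ≤ A`), then
`‖F(zT)‖ ≤ a^ω · A^{1−ω} · exp(Σ_{ζ∈s} log(R/‖ζ − zT‖)) · ‖G(zT)‖`.
(Proof in print: `u = log‖F‖ − log‖g‖ − Σ_ζ [log‖· − ζ‖ + g_Ω(·,ζ)]`… precisely `log‖F‖ − log‖G‖ − Σ_ζ g_Ω(·,ζ)` is subharmonic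
on `Ω`, `≤ log a` resp. `≤ log A` on the two boundary parts; two-constants majorisation; `g_Ω(zT,ζ) ≤ log(R/‖ζ − zT‖)` by domain
monotonicity.  Mathlib has the subharmonic ingredients only in pieces — this is a genuine M-sized formalisation stub.)
[line `jensen-purity-channel`, classical leg P; verbatim; PROVED: `PurityChannelSeams.poissonJensen_holds` ← p635605] -/
def PoissonJensen : Prop :=
  ∀ (U D : Set ℂ) (z₀ zT : ℂ) (δ₀ R : ℝ),
    IsOpen U → IsOpen D → Bornology.IsBounded D → IsConnected D → closure D ⊆ U →
    0 < δ₀ → Metric.closedBall z₀ δ₀ ⊆ D → IsConnected (D \ Metric.closedBall z₀ δ₀) →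
    zT ∈ D → δ₀ < ‖zT - z₀‖ → D ⊆ Metric.ball zT R →
      ∃ ω : ℝ, 0 < ω ∧ ω ≤ 1 ∧
        ∀ (F g : ℂ → ℂ) (s : Multiset ℂ) (a A : ℝ),
          DifferentiableOn ℂ F U → DifferentiableOn ℂ g U → (∀ z ∈ closure D, g z ≠ 0) →
          (∀ ζ ∈ s, ζ ∈ D ∧ δ₀ < ‖ζ - z₀‖ ∧ ζ ≠ zT) →
          0 < a → a ≤ A →
          (∀ z ∈ frontier D, ‖F z‖ ≤ A * ‖g z * zeroProd s z‖) →
          (∀ z ∈ Metric.sphere z₀ δ₀, ‖F z‖ ≤ a * ‖g z * zeroProd s z‖) →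
            ‖F zT‖ ≤ a ^ ω * A ^ (1 - ω) * Real.exp (greenBudget s zT R) * ‖g zT * zeroProd s zT‖

end Summit.QuantumFields.YangMills.Cruxes.IR.PurityChannelFamily

end
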